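import Summits.QuantumFields.YangMills.Theorems.BalabanUVNodesN21ResponseRoadAtRegularSet

/-!
# N21 (NE7c) · the response road at the regular set: BASE REGULARITY ALONG THE CUT FROM THE CENTRE, and an A2∕A6
# witness of the WHOLE hypothesis system of ★★★ `hRT_of_blockExpChart_regular` with a NON-EMPTY shell and a genuine
# dilate (W-SEAT START-LIST v8 §n21; companion of files 7–8 of this seat)

Width seat `pub-ymgap-dag-n21-w3` (g2), node N21 = NE7c (NOT PRINTED in [Bałaban 1983–89], NOT proved), lane K3⁷
`SpineGivenEndpointR13SepCoPH` (stmt-QuantumFields-20544, `--kind proof --supports … --as helper`).  File 9 of this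
seat's response road; consumes BY NAME file 8 `…N21ResponseRoadAtRegularSet` (★ `fieldStrength_closedBall_blockExpChart_of_norm_le`,
★★★ `hRT_of_blockExpChart_regular`, A2 `fieldStrength_reading_admissible`), file 5 `…N21ExponentialChartResponse`
(`blockExpChart_lipschitz`), file 2 `…N21AnalyticResponseRemainder` (`norm_realToComplex_pi`).

WHY (1).  File 8's ★★★∕★★★★ display the base regularity `hreg` AT EVERY CUT POINT `x ∈ K z` («the data in the cut
are `δ`-regular», (L1)∕(L3) of file 4).  On the response road the kept cut `K z` is a ball of radius `R` about the
centre `c z` in the block frame, so `δ`-regularity along the cut FOLLOWS from `δ₀`-regularity AT THE CENTRE by the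
field-strength letter of file 7∕8 (§1: `δ = δ₀ + c̄(ϱ, ℓ′R)·ℓ′R`, `ℓ′ = Ξe^{(ϱ+R′)Ξ}v`, any `R′ > R`): one more
displayed binder of the road becomes a formula in the chart data and the centre's regularity.

WHY (2).  A6 (№189): a junction whose hypotheses are jointly uninhabited is vacuous.  ★★★'s system couples the
NODE-O clause, the chart smallness `ℓ̄r·v′e^{ϱΞ} ≤ ½`, the field-strength budget `δ + c̄ℓ̄r < ε` and the numeral
`c₀ + 4(4S∕r²)R² ≤ (1 − κ₀)θ(1 − ρ)` — and a non-vacuous reading needs a point of the shell `θ(1−ρ) ≤ U < θ` inside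
the cut together with a dilate `s > 1` still in the shell.  §2 exhibits ALL of it at once in the smallest honest model
(`𝔄 = ℂ`, four bonds `B = Fin 4`, one block coordinate `κ = Unit`, the chart `w ↦ (e^{w}, 1, 1, 1)`, `Ψ` = the field
strength `∂V(p₀) − 1` of file 8 §5 at the plaquette `p₀ = (0, 1, 2, 3)`, so `U(x) = |e^{x} − 1|`; `Ξ = v = v′ = 1`,
`r = ¼`, `R = ϱ = 10⁻⁵`, `δ = 2R`, `ε = S = 19`, `θ = 5R∕2`, `ρ = ⅘`, `κ₀ = ½`, `c₀ = 0`): the budget forces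
`ε ≈ 19` while the numeral `4864R² ≤ R∕4` forces `R∕r = 4·10⁻⁵` — the road is consistent exactly in the regime «kept
cut ≪ analyticity radius», which is the regime of print ((L3) `R ≤ δ = ε₁ ≪ a₁`).  (v1.1, dag-n21-w3 g4: this
paragraph and WHAT IS PROVED §2 corrected to the code's letters — ref-O g6 READ-149 NITs; declarations unchanged.)

WHAT IS PROVED ([textbook]∕[bookkeeping]; 0 def, 0 sorry).
* §1 `norm_realToComplex_sub`, `norm_le_of_mem_cut`, ★ `baseRegularity_of_centre` (file 8's `hreg` and `hKϱ` from
  the centre: `‖x‖ ≤ ‖c z‖ + R` and `‖∂χ_z(ι x)(p) − 1‖ ≤ δ₀ + c̄(ϱ, ℓ′R)·ℓ′R` on the cut).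
* §2 A2∕A6: `toy_chart_apply`, `toy_reading_eq`, `toy_U_eq`, `toy_exp_bounds` (`0 ≤ t ≤ 1`); ★ `hRT_toy` — file 8's
  ★★★ applied on the model with EVERY hypothesis discharged; `toy_shell_witness` — the shell ∩ cut contains the point
  `x = R∕2` AND its `s = 2` dilate `x = R`; ★ `hRT_toy_fires` — ★★★ then yields the (true, non-trivial) inequality
  `|e^{R∕2} − 1| + ½·(R∕2)·(2 − 1) ≤ |e^{R} − 1|` for `U(x) = |e^{x} − 1|`, `R = 10⁻⁵`.

HONEST FRAMING.  [textbook]∕[bookkeeping]; the toy of §2 is a MODEL of the letters, not Bałaban's objects; located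
dictionary NOT asserted; nothing of Bałaban's asserted; (M1) ∕ NE7c NOT PRINTED ∕ NOT proved; N21 NOT discharged; K3⁷
NOT claimed; counts unmoved (typed 28∕28 · discharged 5∕27); count-neutral; one finite 𝕋⁴ at fixed ε — YM mass gap
(Clay) is NOT proved by any of this: R4 closes the conditional finite-𝕋⁴ rung `BalabanLadder.UV` only; nothing
continuum ∕ ℝ⁴ ∕ OS ∕ mass gap ∕ Clay.
-/

noncomputable section

open NormedSpace Metric Set

namespace Summit.QuantumFields.YangMills.Theorems.N21ResponseRoadAtRegularSetSanity

open Summit.QuantumFields.YangMills.Theorems.N21ExponentialChartResponse (blockExpChart_lipschitz)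
open Summit.QuantumFields.YangMills.Theorems.N21AnalyticResponseRemainder (norm_realToComplex_pi)
open Summit.QuantumFields.YangMills.Theorems.N21ResponseRoadAtRegularSet
  (fieldStrength_closedBall_blockExpChart_of_norm_le hRT_of_blockExpChart_regular fieldStrength_reading_admissible)

variable {𝔄 : Type*} [NormedRing 𝔄] [NormedAlgebra ℂ 𝔄] [CompleteSpace 𝔄] [NormOneClass 𝔄]
  {κ B : Type*} [Fintype κ] [Fintype B]

/-! ## §1  Base regularity along the cut from regularity at the centre -/

/-- `ι x − ι c = ι (x − c)`, so `‖ι x − ι c‖ = ‖x − c‖` for the real-to-complex embedding of the block frame.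
[bookkeeping] -/
theorem norm_realToComplex_sub (x c : κ → ℝ) :
    ‖(fun i => (x i : ℂ)) - (fun i => (c i : ℂ))‖ = ‖x - c‖ := by
  rw [← norm_realToComplex_pi (x - c)]
  congr 1
  ext i
  simp

/-- a cut point of the ball of radius `R` about the centre has `‖x‖ ≤ ‖c‖ + R` (file 8's `hKϱ` from the centre).
[bookkeeping] -/
theorem norm_le_of_mem_cut {x c : κ → ℝ} {R : ℝ} (h : ‖x - c‖ ≤ R) : ‖x‖ ≤ ‖c‖ + R := by
  calc ‖x‖ = ‖c + (x - c)‖ := by rw [add_sub_cancel]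
    _ ≤ ‖c‖ + ‖x - c‖ := norm_add_le _ _
    _ ≤ ‖c‖ + R := add_le_add le_rfl h

/-- ★ **BASE REGULARITY ALONG THE CUT FROM THE CENTRE** (file 8's `hreg` a formula): if the centre configuration
`χ(ι c)` is `δ₀`-regular on `plaqs`, `‖c‖ ≤ ϱ`, the cut lies in `closedBall c R` with `R < R′`, and
`ℓ′R·v′e^{ϱΞ} ≤ ½` (`ℓ′ = Ξe^{(ϱ+R′)Ξ}v`), then every cut point's configuration `χ(ι x)` is
`(δ₀ + c̄(ϱ, ℓ′R)·ℓ′R)`-regular on `plaqs`, `c̄(ϱ, t) = max(e^{ϱΞ}v + t, 2v′e^{ϱΞ})³(2 + 4(v′e^{ϱΞ})²)`.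
[textbook] -/
theorem baseRegularity_of_centre (X : κ → B → 𝔄) (V₀ : B → 𝔄ˣ) {Ξ v v' R R' δ₀ ϱ : ℝ}
    (hΞ0 : 0 ≤ Ξ) (hΞ : ∀ b, ∑ a, ‖X a b‖ ≤ Ξ) (hv0 : 0 ≤ v) (hv : ∀ b, ‖(V₀ b : 𝔄)‖ ≤ v)
    (hv' : ∀ b, ‖(↑(V₀ b)⁻¹ : 𝔄)‖ ≤ v') {c : κ → ℝ} (hc : ‖c‖ ≤ ϱ) (hRR' : R < R')
    (hsmall : Ξ * Real.exp ((ϱ + R') * Ξ) * v * R * (v' * Real.exp (ϱ * Ξ)) ≤ 1 / 2)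
    (plaqs : Finset (B × B × B × B))
    (hδ₀ : ∀ p ∈ plaqs, ‖exp (∑ a, (c a : ℂ) • X a p.1) * (V₀ p.1 : 𝔄) *
        (exp (∑ a, (c a : ℂ) • X a p.2.1) * (V₀ p.2.1 : 𝔄)) *
        Ring.inverse (exp (∑ a, (c a : ℂ) • X a p.2.2.1) * (V₀ p.2.2.1 : 𝔄)) *
        Ring.inverse (exp (∑ a, (c a : ℂ) • X a p.2.2.2) * (V₀ p.2.2.2 : 𝔄)) - 1‖ ≤ δ₀)
    {x : κ → ℝ} (hx : ‖x - c‖ ≤ R) :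
    ∀ p ∈ plaqs, ‖exp (∑ a, (x a : ℂ) • X a p.1) * (V₀ p.1 : 𝔄) *
        (exp (∑ a, (x a : ℂ) • X a p.2.1) * (V₀ p.2.1 : 𝔄)) *
        Ring.inverse (exp (∑ a, (x a : ℂ) • X a p.2.2.1) * (V₀ p.2.2.1 : 𝔄)) *
        Ring.inverse (exp (∑ a, (x a : ℂ) • X a p.2.2.2) * (V₀ p.2.2.2 : 𝔄)) - 1‖ ≤
      δ₀ + max (Real.exp (ϱ * Ξ) * v + Ξ * Real.exp ((ϱ + R') * Ξ) * v * R) (2 * (v' * Real.exp (ϱ * Ξ))) ^ 3 *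
        (2 + 4 * (v' * Real.exp (ϱ * Ξ)) ^ 2) * (Ξ * Real.exp ((ϱ + R') * Ξ) * v * R) := by
  have hR0 : 0 ≤ R := (norm_nonneg _).trans hx
  have hιc : ‖(fun i => (c i : ℂ))‖ ≤ ϱ := by rw [norm_realToComplex_pi]; exact hc
  -- the cut point's complex image lies in the open `R′`-ball about the centre's image
  have hball : (fun i => (x i : ℂ)) ∈ ball (fun i => (c i : ℂ)) R' := by
    rw [mem_ball, dist_eq_norm, norm_realToComplex_sub]; exact hx.trans_lt hRR'
  -- file 5's Lipschitz letter at the centre, read at the bound `ϱ`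
  have hexp : Real.exp ((‖(fun i => (c i : ℂ))‖ + R') * Ξ) ≤ Real.exp ((ϱ + R') * Ξ) :=
    Real.exp_le_exp.2 (mul_le_mul_of_nonneg_right (by linarith) hΞ0)
  have hL := blockExpChart_lipschitz X (fun b => (V₀ b : 𝔄)) hΞ0 hΞ hv0 hv (fun i => (c i : ℂ)) _ hball
  have hmem : (fun b => exp (∑ a, (x a : ℂ) • X a b) * (V₀ b : 𝔄)) ∈
      closedBall (fun b => exp (∑ a, (c a : ℂ) • X a b) * (V₀ b : 𝔄)) (Ξ * Real.exp ((ϱ + R') * Ξ) * v * R) := by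
    rw [mem_closedBall, dist_eq_norm]
    refine hL.trans ?_
    rw [norm_realToComplex_sub]
    calc Ξ * Real.exp ((‖fun i => (c i : ℂ)‖ + R') * Ξ) * v * ‖x - c‖
        ≤ Ξ * Real.exp ((ϱ + R') * Ξ) * v * ‖x - c‖ := by gcongr
      _ ≤ Ξ * Real.exp ((ϱ + R') * Ξ) * v * R := by gcongr
  exact (fieldStrength_closedBall_blockExpChart_of_norm_le X V₀ hΞ0 hΞ hv hv' hιc hsmall plaqs hδ₀ _ hmem).2

/-! ## §2  A2∕A6: the whole hypothesis system of ★★★ on an explicit model with a non-empty shell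

The model (everything inlined; no definitions): `𝔄 = E = ℂ`, exterior `Z = Unit`, fine plaquettes `P = Unit`, one
block coordinate `κ = Unit`, four bonds `B = Fin 4`, the plaquette `p₀ = (0, 1, 2, 3)`, directions
`X a b = if b = 0 then 1 else 0`, base configuration `V₀ = 1` — so `χ(w) = (e^{w()}, 1, 1, 1)` and
`∂χ(w)(p₀) = e^{w()}` — and `Ψ(V) = ∂V(p₀) − 1` (file 8 §5), so `U(x) = |e^{x()} − 1|`. -/

section Witness

/-- the chart's bond variables in the model: `e^{w()}` on bond `0`, `1` on the bonds `b ≠ 0`. [bookkeeping] -/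
theorem toy_chart_apply (w : Unit → ℂ) (b : Fin 4) :
    exp (∑ a : Unit, w a • (fun (_ : Unit) (b : Fin 4) => if b = 0 then (1 : ℂ) else 0) a b) *
        ((fun _ : Fin 4 => (1 : ℂˣ)) b : ℂ) = if b = 0 then exp (w ()) else 1 := by
  simp only [Fintype.sum_unique, Units.val_one, mul_one]
  split_ifs with hb
  · simp
  · simp

/-- the model's plaquette reading through the chart: `∂χ(w)(p₀) − 1 = e^{w()} − 1`. [bookkeeping] -/
theorem toy_reading_eq (w : Unit → ℂ) :
    (fun (_ : Unit) (_ : Unit) (V : Fin 4 → ℂ) => V 0 * V 1 * Ring.inverse (V 2) * Ring.inverse (V 3) - 1) () ()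
        (fun b => exp (∑ a : Unit, w a • (fun (_ : Unit) (b : Fin 4) => if b = 0 then (1 : ℂ) else 0) a b) *
          ((fun _ : Fin 4 => (1 : ℂˣ)) b : ℂ)) = exp (w ()) - 1 := by
  simp only [toy_chart_apply]
  simp

/-- the model's tested variable at a real block point: `U(x) = |e^{x()} − 1|`. [bookkeeping] -/
theorem toy_U_eq (x : Unit → ℝ) :
    (⨆ _ : Unit, ‖(fun (_ : Unit) (_ : Unit) (V : Fin 4 → ℂ) =>
        V 0 * V 1 * Ring.inverse (V 2) * Ring.inverse (V 3) - 1) () ()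
        (fun b => exp (∑ a : Unit, ((x a : ℝ) : ℂ) •
          (fun (_ : Unit) (b : Fin 4) => if b = 0 then (1 : ℂ) else 0) a b) * ((fun _ : Fin 4 => (1 : ℂˣ)) b : ℂ))‖)
      = |Real.exp (x ()) - 1| := by
  rw [ciSup_const, toy_reading_eq, ← Complex.exp_eq_exp_ℂ, ← Complex.ofReal_exp, ← Complex.ofReal_one,
    ← Complex.ofReal_sub, Complex.norm_real, Real.norm_eq_abs]

/-- `e^t ≤ 1 + 2t` for `0 ≤ t ≤ 1` and `t ≤ e^t − 1` (Mathlib `Real.abs_exp_sub_one_le`, `Real.add_one_le_exp`).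
[bookkeeping] -/
theorem toy_exp_bounds {t : ℝ} (h0 : 0 ≤ t) (h1 : t ≤ 1) :
    t ≤ Real.exp t - 1 ∧ Real.exp t - 1 ≤ 2 * t ∧ |Real.exp t - 1| = Real.exp t - 1 := by
  have hlow : t ≤ Real.exp t - 1 := by linarith [Real.add_one_le_exp t]
  have habs : |Real.exp t - 1| = Real.exp t - 1 := abs_of_nonneg (h0.trans hlow)
  have hup := Real.abs_exp_sub_one_le (x := t) (by rw [abs_of_nonneg h0]; exact h1)
  rw [habs, abs_of_nonneg h0] at hup
  exact ⟨hlow, hup, habs⟩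

/-- ★ **A2∕A6 — FILE 8's ★★★ APPLIED ON THE MODEL WITH EVERY HYPOTHESIS DISCHARGED** (`Ξ = v = v′ = 1`, `r = ¼`,
`ϱ = R = 10⁻⁵`, `δ = 2R`, `ε = S = 19`, `θ = 5R∕2`, `ρ = ⅘`, `κ₀ = ½`, `c₀ = 0`, centre `0`, cut
`K = closedBall 0 R`, `C = {p | p.2 ∈ K}`; the NODE-O clause by file 8 §5; the smallness `e^{R+¼}·¼·e^{R} ≤ ½`,
the budget `2R + max(e^R + ¼e^{R+¼}, 2e^R)³(2 + 4e^{2R})·¼e^{R+¼} < 19` and the numeral `4864R² ≤ R∕4` CHECKED):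
part 34's `hRT` binder for the model's tested variable `U(x) = |e^{x()} − 1|`. [bookkeeping] -/
theorem hRT_toy :
    ∀ p : Unit × (Unit → ℝ), 5 * (1 / 100000 : ℝ) / 2 * (1 - 4 / 5) ≤ (⨆ q : Unit, ‖(fun (_ : Unit) (_ : Unit) (V : Fin 4 → ℂ) => V 0 * V 1 * Ring.inverse (V 2) * Ring.inverse (V 3) - 1) q p.1 (fun b => exp (∑ a : Unit, ((p.2 a : ℝ) : ℂ) • (fun (_ : Unit) (_ : Unit) (b : Fin 4) => if b = 0 then (1 : ℂ) else 0) p.1 a b) * ((fun (_ : Unit) (_ : Fin 4) => (1 : ℂˣ)) p.1 b : ℂ))‖) →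
      (⨆ q : Unit, ‖(fun (_ : Unit) (_ : Unit) (V : Fin 4 → ℂ) => V 0 * V 1 * Ring.inverse (V 2) * Ring.inverse (V 3) - 1) q p.1 (fun b => exp (∑ a : Unit, ((p.2 a : ℝ) : ℂ) • (fun (_ : Unit) (_ : Unit) (b : Fin 4) => if b = 0 then (1 : ℂ) else 0) p.1 a b) * ((fun (_ : Unit) (_ : Fin 4) => (1 : ℂˣ)) p.1 b : ℂ))‖) < 5 * (1 / 100000 : ℝ) / 2 → p ∈ {p : Unit × (Unit → ℝ) | p.2 ∈ closedBall (0 : Unit → ℝ) (1 / 100000 : ℝ)} →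
      ∀ s : ℝ, 1 ≤ s → 5 * (1 / 100000 : ℝ) / 2 * (1 - 4 / 5) ≤ (⨆ q : Unit, ‖(fun (_ : Unit) (_ : Unit) (V : Fin 4 → ℂ) => V 0 * V 1 * Ring.inverse (V 2) * Ring.inverse (V 3) - 1) q p.1 (fun b => exp (∑ a : Unit, (((0 + s • (p.2 - 0)) a : ℝ) : ℂ) • (fun (_ : Unit) (_ : Unit) (b : Fin 4) => if b = 0 then (1 : ℂ) else 0) p.1 a b) * ((fun (_ : Unit) (_ : Fin 4) => (1 : ℂˣ)) p.1 b : ℂ))‖) → (⨆ q : Unit, ‖(fun (_ : Unit) (_ : Unit) (V : Fin 4 → ℂ) => V 0 * V 1 * Ring.inverse (V 2) * Ring.inverse (V 3) - 1) q p.1 (fun b => exp (∑ a : Unit, (((0 + s • (p.2 - 0)) a : ℝ) : ℂ) • (fun (_ : Unit) (_ : Unit) (b : Fin 4) => if b = 0 then (1 : ℂ) else 0) p.1 a b) * ((fun (_ : Unit) (_ : Fin 4) => (1 : ℂˣ)) p.1 b : ℂ))‖) < 5 * (1 / 100000 : ℝ) / 2 →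
        (p.1, (0 : Unit → ℝ) + s • (p.2 - 0)) ∈ {p : Unit × (Unit → ℝ) | p.2 ∈ closedBall (0 : Unit → ℝ) (1 / 100000 : ℝ)} →
        (⨆ q : Unit, ‖(fun (_ : Unit) (_ : Unit) (V : Fin 4 → ℂ) => V 0 * V 1 * Ring.inverse (V 2) * Ring.inverse (V 3) - 1) q p.1 (fun b => exp (∑ a : Unit, ((p.2 a : ℝ) : ℂ) • (fun (_ : Unit) (_ : Unit) (b : Fin 4) => if b = 0 then (1 : ℂ) else 0) p.1 a b) * ((fun (_ : Unit) (_ : Fin 4) => (1 : ℂˣ)) p.1 b : ℂ))‖) + 1 / 2 * (5 * (1 / 100000 : ℝ) / 2 * (1 - 4 / 5)) * (s - 1) ≤ (⨆ q : Unit, ‖(fun (_ : Unit) (_ : Unit) (V : Fin 4 → ℂ) => V 0 * V 1 * Ring.inverse (V 2) * Ring.inverse (V 3) - 1) q p.1 (fun b => exp (∑ a : Unit, (((0 + s • (p.2 - 0)) a : ℝ) : ℂ) • (fun (_ : Unit) (_ : Unit) (b : Fin 4) => if b = 0 then (1 : ℂ) else 0) p.1 a b) * ((fun (_ : Unit) (_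 : Fin 4) => (1 : ℂˣ)) p.1 b : ℂ))‖) := by
  -- the two exponential letters of the model
  obtain ⟨-, hA, -⟩ := toy_exp_bounds (t := (1 / 100000 : ℝ)) (by norm_num) (by norm_num)
  obtain ⟨-, hB, -⟩ := toy_exp_bounds (t := (1 / 100000 : ℝ) + 1 / 4) (by norm_num) (by norm_num)
  have hA0 : 0 < Real.exp (1 / 100000 : ℝ) := Real.exp_pos _
  have hB0 : 0 < Real.exp ((1 / 100000 : ℝ) + 1 / 4) := Real.exp_pos _
  have hp₀ : ((0 : Fin 4), (1 : Fin 4), (2 : Fin 4), (3 : Fin 4)) ∈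
      ({((0 : Fin 4), (1 : Fin 4), (2 : Fin 4), (3 : Fin 4))} : Finset (Fin 4 × Fin 4 × Fin 4 × Fin 4)) :=
    Finset.mem_singleton_self _
  have hΨ := fieldStrength_reading_admissible (𝔄 := ℂ)
    ({((0 : Fin 4), (1 : Fin 4), (2 : Fin 4), (3 : Fin 4))} : Finset (Fin 4 × Fin 4 × Fin 4 × Fin 4)) 19 hp₀
  refine hRT_of_blockExpChart_regular (𝔄 := ℂ) (κ := Unit) (B := Fin 4) (Z := Unit) (P := Unit) (E := ℂ)
    (fun (_ : Unit) (_ : Unit) (b : Fin 4) => if b = 0 then (1 : ℂ) else 0) (fun (_ : Unit) (_ : Fin 4) => (1 : ℂˣ)) (Ξ := 1) (v := 1) (v' := 1) (r := 1 / 4) (S := 19) (δ := 2 * (1 / 100000 : ℝ)) (ε := 19) (ϱ := (1 / 100000 : ℝ))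
    (R := (1 / 100000 : ℝ)) (c₀ := 0) (θ := 5 * (1 / 100000 : ℝ) / 2) (ρ := 4 / 5) (κ₀ := 1 / 2) zero_le_one ?_ zero_le_one
    (fun _ _ => by simp) (fun _ _ => by simp) (by norm_num) (by norm_num) ?_
    {((0 : Fin 4), (1 : Fin 4), (2 : Fin 4), (3 : Fin 4))} ?_ (fun (_ : Unit) (_ : Unit) (V : Fin 4 → ℂ) => V 0 * V 1 * Ring.inverse (V 2) * Ring.inverse (V 3) - 1) (fun _ _ => hΨ.1) (fun _ _ => hΨ.2)
    (fun _ => closedBall (0 : Unit → ℝ) (1 / 100000 : ℝ)) (fun _ x hx => mem_closedBall_zero_iff.1 hx) ?_ (fun _ => 0)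
    (fun _ => mem_closedBall_self (by norm_num)) (fun _ w hw => by rwa [sub_zero, ← mem_closedBall_zero_iff])
    (by norm_num) ?_ (fun p hp => hp) (by norm_num)
  · -- `hΞ`: `Σ_a ‖X a b‖ ≤ 1`
    intro _ b
    simp only [Fintype.sum_unique]
    split_ifs <;> simp
  · -- smallness: `e^{R+¼}·¼·e^{R} ≤ ½`
    have hA' : Real.exp (1 / 100000 : ℝ) ≤ 1 + 2 * (1 / 100000) := by linarith
    have hB' : Real.exp ((1 / 100000 : ℝ) + 1 / 4) ≤ 1 + 2 * (1 / 100000 + 1 / 4) := by linarith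
    have hAB := mul_le_mul hB' hA' hA0.le (by norm_num)
    simp only [one_mul, mul_one]
    nlinarith [hAB, hA0, hB0]
  · -- the field-strength budget `< ε = 19`
    simp only [one_mul, mul_one]
    have hmax : max (Real.exp (1 / 100000 : ℝ) + Real.exp ((1 / 100000 : ℝ) + 1 / 4) * (1 / 4)) (2 * Real.exp (1 / 100000 : ℝ)) ≤ 20002 / 10000 :=
      max_le (by linarith) (by linarith)
    have hm0 : 0 ≤ max (Real.exp (1 / 100000 : ℝ) + Real.exp ((1 / 100000 : ℝ) + 1 / 4) * (1 / 4)) (2 * Real.exp (1 / 100000 : ℝ)) :=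
      le_max_of_le_right (by positivity)
    have hpow : max (Real.exp (1 / 100000 : ℝ) + Real.exp ((1 / 100000 : ℝ) + 1 / 4) * (1 / 4)) (2 * Real.exp (1 / 100000 : ℝ)) ^ 3 ≤
        (20002 / 10000 : ℝ) ^ 3 := pow_le_pow_left₀ hm0 hmax 3
    have hsq : 2 + 4 * Real.exp (1 / 100000 : ℝ) ^ 2 ≤ 60009 / 10000 := by nlinarith
    have hq : Real.exp ((1 / 100000 : ℝ) + 1 / 4) * (1 / 4) ≤ 37501 / 100000 := by linarith
    calc 2 * (1 / 100000 : ℝ) + max (Real.exp (1 / 100000 : ℝ) + Real.exp ((1 / 100000 : ℝ) + 1 / 4) * (1 / 4)) (2 * Real.exp (1 / 100000 : ℝ)) ^ 3 *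
          (2 + 4 * Real.exp (1 / 100000 : ℝ) ^ 2) * (Real.exp ((1 / 100000 : ℝ) + 1 / 4) * (1 / 4))
        ≤ 2 * (1 / 100000 : ℝ) + (20002 / 10000 : ℝ) ^ 3 * (60009 / 10000) * (37501 / 100000) := by gcongr
      _ < 19 := by norm_num
  · -- base regularity `2R` along the cut: `|e^{x()} − 1| ≤ 2|x()| ≤ 2R`
    intro _ x hx p hp
    rw [Finset.mem_singleton] at hp
    subst hp
    have hx' : |x ()| ≤ (1 / 100000 : ℝ) := by
      rw [← Real.norm_eq_abs]; exact (norm_le_pi_norm x ()).trans (mem_closedBall_zero_iff.1 hx)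
    have hval : ‖exp ((x () : ℝ) : ℂ) - 1‖ = |Real.exp (x ()) - 1| := by
      rw [← Complex.exp_eq_exp_ℂ, ← Complex.ofReal_exp, ← Complex.ofReal_one, ← Complex.ofReal_sub,
        Complex.norm_real, Real.norm_eq_abs]
    have hb := Real.abs_exp_sub_one_le (x := x ()) (hx'.trans (by norm_num))
    simp only [Fin.isValue, ↓reduceIte, one_ne_zero, Fin.reduceEq, Fintype.sum_unique, PUnit.default_eq_unit,
      smul_eq_mul, mul_one, mul_zero, NormedSpace.exp_zero, Units.val_one, Ring.inverse_one]
    rw [hval]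
    linarith
  · -- core reading at the centre: `e^0 − 1 = 0`
    intro _ _
    simp

/-- **THE SHELL OF THE MODEL IS NON-EMPTY AND CARRIES A GENUINE DILATE**: the cut point `x = R∕2` and its `s = 2`
dilate `x = R` both lie in the shell `[θ(1−ρ), θ) = [R∕2, 5R∕2)` and in the cut — every antecedent of `hRT_toy` is
met. [bookkeeping] -/
theorem toy_shell_witness :
    5 * (1 / 100000 : ℝ) / 2 * (1 - 4 / 5) ≤ |Real.exp ((1 / 100000 : ℝ) / 2) - 1| ∧ |Real.exp ((1 / 100000 : ℝ) / 2) - 1| < 5 * (1 / 100000 : ℝ) / 2 ∧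
      (fun _ : Unit => (1 / 100000 : ℝ) / 2) ∈ closedBall (0 : Unit → ℝ) (1 / 100000 : ℝ) ∧
      5 * (1 / 100000 : ℝ) / 2 * (1 - 4 / 5) ≤ |Real.exp (1 / 100000 : ℝ) - 1| ∧ |Real.exp (1 / 100000 : ℝ) - 1| < 5 * (1 / 100000 : ℝ) / 2 ∧
      (fun _ : Unit => (1 / 100000 : ℝ)) ∈ closedBall (0 : Unit → ℝ) (1 / 100000 : ℝ) := by
  obtain ⟨h1, h2, h3⟩ := toy_exp_bounds (t := (1 / 100000 : ℝ) / 2) (by norm_num) (by norm_num)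
  obtain ⟨h4, h5, h6⟩ := toy_exp_bounds (t := (1 / 100000 : ℝ)) (by norm_num) (by norm_num)
  refine ⟨by rw [h3]; linarith, by rw [h3]; linarith, ?_, by rw [h6]; linarith, by rw [h6]; linarith, ?_⟩
  · rw [mem_closedBall_zero_iff]
    exact (pi_norm_le_iff_of_nonneg (by norm_num)).2 fun _ => by rw [Real.norm_eq_abs, abs_of_pos (by norm_num)]; norm_num
  · rw [mem_closedBall_zero_iff]
    exact (pi_norm_le_iff_of_nonneg (by norm_num)).2 fun _ => by rw [Real.norm_eq_abs, abs_of_pos (by norm_num)]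

/-- ★ **`hRT_toy` FIRES**: feeding the witness of `toy_shell_witness` into `hRT_toy` gives the (true, non-trivial)
radial-transversality inequality `|e^{R∕2} − 1| + ½·(R∕2)·(2 − 1) ≤ |e^{R} − 1|`, `R = 10⁻⁵` — the junction of
file 8 is NOT vacuous. [bookkeeping] -/
theorem hRT_toy_fires :
    |Real.exp ((1 / 100000 : ℝ) / 2) - 1| + 1 / 2 * (5 * (1 / 100000 : ℝ) / 2 * (1 - 4 / 5)) * (2 - 1) ≤ |Real.exp (1 / 100000 : ℝ) - 1| := by
  obtain ⟨a1, a2, a3, a5, a6, a7⟩ := toy_shell_witness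
  have h := hRT_toy ((), fun _ => (1 / 100000 : ℝ) / 2)
  rw [toy_U_eq] at h
  have h' := h a1 a2 a3 2 (by norm_num)
  have hdil : ((0 : Unit → ℝ) + (2 : ℝ) • ((fun _ : Unit => (1 / 100000 : ℝ) / 2) - 0)) = fun _ => (1 / 100000 : ℝ) := by
    ext; simp; ring
  rw [hdil, toy_U_eq] at h'
  exact h' a5 a6 a7

end Witness

end Summit.QuantumFields.YangMills.Theorems.N21ResponseRoadAtRegularSetSanity
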